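import Literature.AnabelianGeometry.EtaleTheta.Discharge.Sec3OfGaloisCoveringConnectedRealified
import Literature.AnabelianGeometry.EtaleTheta.Discharge.Sec3Cor38iiSelfEquivalenceWeak
import Literature.AnabelianGeometry.EtaleTheta.Discharge.Sec3Cor38iiWeakOfRatSupport
import Literature.AnabelianGeometry.EtaleTheta.Discharge.Sec3Def36iOfGaloisCovering
import Literature.AnabelianGeometry.EtaleTheta.Discharge.Sec3Prop34iPhiZero
import Literature.AnabelianGeometry.EtaleTheta.Discharge.Sec3WeakColumnOfProp34Const
import Literature.AnabelianGeometry.EtaleTheta.Discharge.Sec3HQToyGenuine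
import Literature.AnabelianGeometry.EtaleTheta.Discharge.Sec3Thm37ivGenuineBase
import Literature.AnabelianGeometry.EtaleTheta.DivisorMonoidsConstants34
import HarnessLib

/-!
# [EtTh] Corollary 3.8 (i) and (ii) AS TYPED for EVERY tempered Frobenioid with print's divisor monoid over the
# CONSTRUCTED Def. 3.3 (iii) data of the connected coverings — residual = `Prop34Const` of the model ONLY

S. Mochizuki, *The étale theta function and its Frobenioid-theoretic manifestations*, Publ. RIMS **45** (2009),
Cor. 3.8 (i)/(ii), statement PDF p. 80, proof pp. 81–82 [cite: MochizukiEtTh2009, Cor 3.8 p.80]; Def. 3.3 (iii) p. 73,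
Rmk. 3.3.1 p. 73 ("the set of primes … of `Div⁺(Z^log_∞)^{Gal(Z^log_∞/Y^log)}` … is in natural bijective correspondence with the
set of `Gal(Z^log_∞/Y^log)`-orbits of prime log-divisors"), Prop. 3.4 (i)/(ii) p. 74, Def. 3.6 (i)/(ii) pp. 76–77, Ex. 3.9 (iii)
p. 84 ("`Φ_W` … the perfection of the monoid `Φ₀`"), Rmk. 3.6.3 p. 79; S. Mochizuki, *The geometry of Frobenioids I* (2008),
§0 p. 10, Thm. 5.2 (ii) p. 100 [cite: MochizukiFrdI2008, Thm. 5.2(ii) p.100].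

abc-iut cell, layer L2, cone nodes `EtTh:Cor3.8(i)` / `EtTh:Cor3.8(ii)`, seat abc-iut-L2-d2 (gen 5).  PROOF-ONLY (0 definitions)
— the (i)/(ii) SIBLING of abc-iut-w6-d052's `Sec3Cor38iiiOfGaloisCoveringConnectedKnit.lean` (p443434/p444329: Cor. 3.8 (iii),
first clause, at the same data with the same residual), in the same generality: tempered Frobenioids `C_i` over
abc-iut-L6-t12's weak data of record `ofRlfZWeak (DivisorMonoids.ofGaloisActionConnected A_i hZ_i) hpf_i` (abc-iut-w6-d058's
CONSTRUCTED Def. 3.3 (iii) data `Φ₀ = Hom_G(−, Div⁺(Z_∞))`, `B₀ = Hom_G(−, Mero(Z_∞))`, `F₀` = the constant ones, of the connected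
coverings dominated by a universal combinatorial covering `Z_∞` with Galois group `G`), whose divisor monoid is print's
`Φ_i(B) = ι(Φ₀(Y_B)^pf)` (the Φ-tie `hΦ_i`, Ex. 3.9 (iii)), over ANY base `D_i → D₀`.

THE CLOSERS are the `Λ`-generic weak node closers `Cor38Hyp.cor38_i_weak_of_coord` (abc-iut-w6-d039, p439433) and
`Cor38Hyp.cor38_ii_weak_of_coord` / `TemperedFrobenioid.hull_selfEquivalence_weak_of_coord` (abc-iut-L1-t12, p441772), inputs per
side `hF` ([FrdI] Thm. 5.2 (ii)) · `hP34Λ` (Prop. 3.4 (ii) at monoid type `Λ`) · `hNZ` (Def. 3.6 (ii)(b), bracketed sentence) · `hQ`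
(Rmk. 3.3.1 / [FrdI] Def. 2.4 (i)(b)) · [`hFinv` — (ii) only].  §1 shows that at this data EVERY ONE is a theorem modulo
`Prop34Const` and the Φ-tie:

* **`hP34Λ_ofGaloisActionConnected_weak`** (EVERY connected covering `Y`): abc-iut-L6-t12's `ofRlfZWeak_mem_FΛ_of_divΛ_eq_of` over
  abc-iut-w6-d058's THEOREM `DivisorMonoids.prop34_ofGaloisActionConnected` ([EtTh] Prop. 3.4 (i)+(ii) proved at the data);
* **`hFinv_ofGaloisActionConnected_weak`** (every `Y`): `F₀(Y) = Hom_G(Y, L^×)` is a group (abc-iut-w6-d058's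
  `GaloisAction.exists_inv_mem_fZero`, through abc-iut-L6-t12's `ofRlfZWeak_hFinv_iff`);
* **`isZQMonoprime_primes_Φ₀_ofGaloisActionConnected`** (every `Y`) — (hZQ): EVERY prime component `Φ₀(Y)_𝔭 ≅ ℤ_{≥0}`
  (abc-iut-w6-d057's `GaloisAction.isZMonoprime_submonoid_primes_phiZero`: primes = Galois orbits of prime log-divisors,
  Rmk. 3.3.1); `ratSupport_of_eq_mrange` (hsat from the Φ-tie); hence **`hQ_of_eq_mrange`** — the binder `hQ` of row C38-L05
  (GAP G-w4d084-3) is a THEOREM for every such `C`;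
* `hNZ` := abc-iut-L6-t12's `exists_cnstFn_effective_ofRlfZWeak_of_prop34Const` ⟸ abc-iut-L2-t3's binder of record
  `Prop34Const` (G-L2d2-3) — the ONE residual;
* `hF` either a binder (§2, any category vocabulary), or ⟸ `IsOfFSMType D` (§3, abc-iut-w5-d179's
  `isFrobenioid_of_isOfFSMType` ∘ `ofGaloisActionConnected_ofRlfZWeak_hBinj`), or UNCONDITIONAL at print's genuine base
  `B^temp(Π)⁰` (§4, `isFrobenioid_connectedPart_bTemp`).

RESULTS: `Cor38Hyp.cor38_i/ii_ofGaloisActionConnected_of_isFrobenioid_of_eq_mrange` (§2),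
**`…_of_isOfFSMType_of_eq_mrange`** (§3), **`…_connectedPart_bTemp_of_eq_mrange`** (§4),
`TemperedFrobenioid.hull_selfEquivalence_ofGaloisActionConnected_of_eq_mrange` (every self-equivalence lifts to the real hull) — with
abc-iut-w6-d052's (iii) knit (same residual): [EtTh] Cor. 3.8 (i), (ii), (iii) AS TYPED for EVERY Cor. 3.8 datum between tempered
Frobenioids with print's `Φ` over the constructed connected data of ANY two `LogDivisorModel` / `GaloisAction` records, over FSM-type
bases resp. the GENUINE bases `B^temp(Π)⁰`, modulo `Prop34Const` of the two records ONLY (proved for the Tate tower by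
abc-iut-w6-d052, p448109, and for the one-component model in this seat's sequel; the three-part conjunction is filed as a sequel).

HONEST LIMIT: `Prop34Const` is a property of the genuine geometric data (G-L2d2-3), a hypothesis here; the Φ-tie is print's
choice of `Φ` (Ex. 3.9 (iii)), not a consequence of Def. 3.6 (ii).  HONEST FRAMING: classical bookkeeping over typed interfaces
(`LogDivisorModel` / `GaloisAction` are parameter records; nothing asserts they arise from a curve); refereed pre-IUT material;
nothing here bears on [IUTchIII] Cor. 3.12; no side taken; typed ≠ proved — here proved modulo the displayed named binders.
-/

noncomputable section

namespace Literature.AnabelianGeometry.EtaleTheta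

open CategoryTheory Opposite Function Literature.AlgebraicGeometry.Frobenioids Literature.AnabelianGeometry.SemiGraphs
  LogDivisorModel.GaloisAction

universe u u' v'

/-! ## §1 The print-level inputs at the constructed connected data -/

namespace TemperedFrobenioid

section Inputs

variable {Z : LogDivisorModel.{u}} {G : Type u} [Group G] (A : Z.GaloisAction G) (hZ : Z.CuspLaws)
  (hpf : ∀ Y : ((isConnectedGSet (G := G)).FullSubcategory)ᵒᵖ,
    IsPerfFactorialCof ((DivisorMonoids.ofGaloisActionConnected A hZ).Φ₀.obj Y))

/-- **`hP34Λ` for EVERY connected covering of the model** ([EtTh] Prop. 3.4 (ii) at monoid type `ℤ`: a function whose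
`Λ`-divisor is effective in `(Φ₀^ℝ)^gp` is constant): abc-iut-L6-t12's `ofRlfZWeak_mem_FΛ_of_divΛ_eq_of` over abc-iut-w6-d058's THEOREM
`DivisorMonoids.prop34_ofGaloisActionConnected`. [cite: MochizukiEtTh2009, Prop 3.4 (ii) p.74] -/
theorem hP34Λ_ofGaloisActionConnected_weak (Y : ((isConnectedGSet (G := G)).FullSubcategory)ᵒᵖ)
    (b : (RealifiedDivisorMonoids.ofRlfZWeak (DivisorMonoids.ofGaloisActionConnected A hZ) hpf).BΛ.obj Y)
    (r : (RealifiedDivisorMonoids.ofRlfZWeak (DivisorMonoids.ofGaloisActionConnected A hZ) hpf).ΦR.obj Y)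
    (h : (RealifiedDivisorMonoids.ofRlfZWeak (DivisorMonoids.ofGaloisActionConnected A hZ) hpf).divΛ Y b =
      Algebra.GrothendieckGroup.of r) :
    b ∈ (RealifiedDivisorMonoids.ofRlfZWeak (DivisorMonoids.ofGaloisActionConnected A hZ) hpf).FΛ Y :=
  RealifiedDivisorMonoids.ofRlfZWeak_mem_FΛ_of_divΛ_eq_of _ hpf
    (DivisorMonoids.prop34_ofGaloisActionConnected A hZ (fun _ => True) fun _ => True) Y b r h

/-- **`hFinv` for EVERY connected covering of the model** (`F₀^ℤ(Y) = F₀(Y) = Hom_G(Y, L^×)` is a group: abc-iut-w6-d058's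
`GaloisAction.exists_inv_mem_fZero` through abc-iut-L6-t12's `ofRlfZWeak_hFinv_iff`). [cite: MochizukiEtTh2009, Prop 3.4 (ii) p.74] -/
theorem hFinv_ofGaloisActionConnected_weak (Y : ((isConnectedGSet (G := G)).FullSubcategory)ᵒᵖ)
    (b : (RealifiedDivisorMonoids.ofRlfZWeak (DivisorMonoids.ofGaloisActionConnected A hZ) hpf).BΛ.obj Y)
    (hb : b ∈ (RealifiedDivisorMonoids.ofRlfZWeak (DivisorMonoids.ofGaloisActionConnected A hZ) hpf).FΛ Y) :
    ∃ b' ∈ (RealifiedDivisorMonoids.ofRlfZWeak (DivisorMonoids.ofGaloisActionConnected A hZ) hpf).FΛ Y, b' * b = 1 :=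
  (RealifiedDivisorMonoids.ofRlfZWeak_hFinv_iff _ hpf).2 (fun Y' b' hb' => A.exists_inv_mem_fZero Y'.unop.obj b' hb') Y b hb

/-- **(hZQ) for EVERY connected covering of the model** — [EtTh] Rmk. 3.3.1: every prime component `Φ₀(Y)_𝔭` of
`Φ₀(Y) = Hom_G(Y, Div⁺(Z_∞))` is `ℤ`-monoprime (abc-iut-w6-d057's `GaloisAction.isZMonoprime_submonoid_primes_phiZero`: primes ↔
Galois orbits of prime log-divisors). [cite: MochizukiEtTh2009, Rmk 3.3.1 p.73] -/
theorem isZQMonoprime_primes_Φ₀_ofGaloisActionConnected (Y : ((isConnectedGSet (G := G)).FullSubcategory)ᵒᵖ)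
    (𝔭 : Primes ((DivisorMonoids.ofGaloisActionConnected A hZ).Φ₀.obj Y)) :
    IsZMonoprime ↥𝔭.submonoid ∨ IsQMonoprime ↥𝔭.submonoid :=
  Or.inl (isZMonoprime_submonoid_primes_phiZero A Y.unop.obj 𝔭)

variable {A hZ hpf} {D : Type u'} [Category.{v'} D] {VD : FrdICatStub.{u', v', u} D}
  (C : TemperedFrobenioid (RealifiedDivisorMonoids.ofRlfZWeak (DivisorMonoids.ofGaloisActionConnected A hZ) hpf) D VD)

/-- **(hsat) from the Φ-tie**: if `Φ(B) = ι(Φ₀(Y_B)^pf)` (print's `Φ`, Ex. 3.9 (iii)), every `x ∈ Φ(B)` has a power in the image of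
`Φ₀(Y_B)` (`ι(c^{1/n})^n = ι(c)`). [cite: MochizukiEtTh2009, Ex 3.9 p.84] -/
theorem ratSupport_of_eq_mrange
    (hΦ : ∀ B : Dᵒᵖ, C.Φ.carrier B = MonoidHom.mrange (hpf (C.baseOp B)).weak.toRealification) (W : D) :
    ∀ x ∈ C.Φ.carrier (op W),
      ∃ (N : ℕ+) (d : (DivisorMonoids.ofGaloisActionConnected A hZ).Φ₀.obj (C.baseOp (op W))),
        x ^ (N : ℕ) = (hpf (C.baseOp (op W))).weak.toRealification (Perfection.of _ d) := by
  intro x hx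
  rw [hΦ] at hx
  obtain ⟨a, rfl⟩ := hx
  obtain ⟨⟨c, n⟩, rfl⟩ := Perfection.mk_surjective a
  refine ⟨n, c, ?_⟩
  change (hpf _).weak.toRealification (Perfection.mk c n) ^ (n : ℕ) = (hpf _).weak.toRealification (Perfection.of _ c)
  rw [← map_pow, Perfection.mk_pow_self]

/-- **`hQ` (row C38-L05, GAP G-w4d084-3) is a THEOREM for every tempered Frobenioid with print's `Φ` over the constructed
connected data**: every localized perfection `Φ(W)^pf_𝔮` is `ℚ`-monoprime (abc-iut-L6-t12's `hQ_ofRlfZWeak_of_ratSupport` with (hZQ),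
(hsat) above). [cite: MochizukiEtTh2009, Def 3.6 p.77] -/
theorem hQ_of_eq_mrange
    (hΦ : ∀ B : Dᵒᵖ, C.Φ.carrier B = MonoidHom.mrange (hpf (C.baseOp B)).weak.toRealification) (W : D)
    (𝔮 : Primes (Perfection (C.divisorMonoid.obj (op W)))) : IsQMonoprime (PfAt (C.divisorMonoid.obj (op W)) 𝔮) :=
  C.hQ_ofRlfZWeak_of_ratSupport W (fun 𝔭 => isZQMonoprime_primes_Φ₀_ofGaloisActionConnected A hZ _ 𝔭)
    (C.ratSupport_of_eq_mrange hΦ W) 𝔮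

/-- **[EtTh] Cor. 3.8 (ii) for EVERY self-equivalence** of such a `C` (base `D` of FSMFF-type, `Φ` non-dilating, `D` Div-slim),
modulo `hF`, the Φ-tie and `Prop34Const`: abc-iut-L1-t12's `hull_selfEquivalence_weak_of_coord` with `hP34Λ`, `hNZ`, `hQ`, `hFinv`
supplied. [cite: MochizukiEtTh2009, Cor 3.8 p.81] -/
theorem hull_selfEquivalence_ofGaloisActionConnected_of_eq_mrange (hD : IsOfFSMFFType D)
    (hnd : ∀ (B : Dᵒᵖ) (f : B ⟶ B), treeMonoidVocabWeak.{u}.IsNonDilating (C.Φ.carrier B) (C.Φ.pull f))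
    (hds : ∀ (B : D) (α : Aut (Over.forget B)),
      (∀ (B' : Over B) (x : C.divisorMonoid.obj (op B'.left)),
        Literature.AlgebraicGeometry.Frobenioids.pull C.divisorMonoid (α.hom.app B') x = x) → α = 1)
    (hF : PreFrobenioid.IsFrobenioid C.toElem)
    (hΦ : ∀ B : Dᵒᵖ, C.Φ.carrier B = MonoidHom.mrange (hpf (C.baseOp B)).weak.toRealification)
    (hC : (DivisorMonoids.ofGaloisActionConnected A hZ).Prop34Const) (e : C.category ≌ C.category) :
    (∀ {X Y : C.category} (f : X ⟶ Y), C.IsBaseFieldTheoretic f ↔ C.IsBaseFieldTheoretic (e.functor.map f)) ∧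
      ∃ e' : C.hullCategory ≌ C.hullCategory, Nonempty (C.hull ⋙ e.functor ≅ e'.functor ⋙ C.hull) :=
  C.hull_selfEquivalence_weak_of_coord hD hnd hds hF (hP34Λ_ofGaloisActionConnected_weak A hZ hpf)
    (C.exists_cnstFn_effective_ofRlfZWeak_of_prop34Const hC) (C.hQ_of_eq_mrange hΦ)
    (hFinv_ofGaloisActionConnected_weak A hZ hpf) e

end Inputs

end TemperedFrobenioid

namespace Cor38Hyp

/-! ## §2 Any category vocabularies: residual {`hF_i`, Φ-ties, `Prop34Const_i`} -/

section Connected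

variable {Z : LogDivisorModel.{u}} {G : Type u} [Group G] {A : Z.GaloisAction G} {hZ : Z.CuspLaws}
  {hpf : ∀ Y : ((isConnectedGSet (G := G)).FullSubcategory)ᵒᵖ,
    IsPerfFactorialCof ((DivisorMonoids.ofGaloisActionConnected A hZ).Φ₀.obj Y)}
  {Z' : LogDivisorModel.{u}} {G' : Type u} [Group G'] {A' : Z'.GaloisAction G'} {hZ' : Z'.CuspLaws}
  {hpf' : ∀ Y : ((isConnectedGSet (G := G')).FullSubcategory)ᵒᵖ,
    IsPerfFactorialCof ((DivisorMonoids.ofGaloisActionConnected A' hZ').Φ₀.obj Y)}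
  {D : Type u'} [Category.{v'} D] {VD : FrdICatStub.{u', v', u} D}
  {D' : Type u'} [Category.{v'} D'] {VD' : FrdICatStub.{u', v', u} D'}
  {C₁ : TemperedFrobenioid
    (RealifiedDivisorMonoids.ofRlfZWeak (DivisorMonoids.ofGaloisActionConnected A hZ) hpf) D VD}
  {C₂ : TemperedFrobenioid
    (RealifiedDivisorMonoids.ofRlfZWeak (DivisorMonoids.ofGaloisActionConnected A' hZ') hpf') D' VD'}

/-- **[EtTh] Cor. 3.8 (i) AS TYPED for tempered Frobenioids with print's `Φ` over the constructed connected data, ANY category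
vocabularies**: inputs `h`, `hF_i` ([FrdI] Thm. 5.2 (ii)), the Φ-ties, `Prop34Const_i` — `hP34Λ`, `hQ`, `hFinv` being THEOREMS
at this data (§1), `hNZ` ⟸ `Prop34Const`. [cite: MochizukiEtTh2009, Cor 3.8 p.80] -/
theorem cor38_i_ofGaloisActionConnected_of_isFrobenioid_of_eq_mrange (h : Cor38Hyp C₁ C₂)
    (hF₁ : PreFrobenioid.IsFrobenioid C₁.toElem) (hF₂ : PreFrobenioid.IsFrobenioid C₂.toElem)
    (hΦ₁ : ∀ B : Dᵒᵖ, C₁.Φ.carrier B = MonoidHom.mrange (hpf (C₁.baseOp B)).weak.toRealification)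
    (hΦ₂ : ∀ B : D'ᵒᵖ, C₂.Φ.carrier B = MonoidHom.mrange (hpf' (C₂.baseOp B)).weak.toRealification)
    (hC₁ : (DivisorMonoids.ofGaloisActionConnected A hZ).Prop34Const)
    (hC₂ : (DivisorMonoids.ofGaloisActionConnected A' hZ').Prop34Const) :
    Literature.AnabelianGeometry.EtaleTheta.Cor38_i
      (fun E _ => Literature.AlgebraicGeometry.Frobenioids.IsFrobeniusSlim E) h :=
  h.cor38_i_weak_of_coord hF₁ hF₂ (TemperedFrobenioid.hP34Λ_ofGaloisActionConnected_weak A hZ hpf)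
    (C₁.exists_cnstFn_effective_ofRlfZWeak_of_prop34Const hC₁) (C₁.hQ_of_eq_mrange hΦ₁)
    (TemperedFrobenioid.hP34Λ_ofGaloisActionConnected_weak A' hZ' hpf')
    (C₂.exists_cnstFn_effective_ofRlfZWeak_of_prop34Const hC₂) (C₂.hQ_of_eq_mrange hΦ₂)

/-- **[EtTh] Cor. 3.8 (ii) AS TYPED for tempered Frobenioids with print's `Φ` over the constructed connected data, ANY category
vocabularies** (same inputs; `hFinv_i` are theorems). [cite: MochizukiEtTh2009, Cor 3.8 p.81] -/
theorem cor38_ii_ofGaloisActionConnected_of_isFrobenioid_of_eq_mrange (h : Cor38Hyp C₁ C₂)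
    (hF₁ : PreFrobenioid.IsFrobenioid C₁.toElem) (hF₂ : PreFrobenioid.IsFrobenioid C₂.toElem)
    (hΦ₁ : ∀ B : Dᵒᵖ, C₁.Φ.carrier B = MonoidHom.mrange (hpf (C₁.baseOp B)).weak.toRealification)
    (hΦ₂ : ∀ B : D'ᵒᵖ, C₂.Φ.carrier B = MonoidHom.mrange (hpf' (C₂.baseOp B)).weak.toRealification)
    (hC₁ : (DivisorMonoids.ofGaloisActionConnected A hZ).Prop34Const)
    (hC₂ : (DivisorMonoids.ofGaloisActionConnected A' hZ').Prop34Const) :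
    Literature.AnabelianGeometry.EtaleTheta.Cor38_ii
      (fun E _ Φ => ∀ (B : E) (α : Aut (Over.forget B)),
        (∀ (B' : Over B) (x : Φ.obj (op B'.left)),
          Literature.AlgebraicGeometry.Frobenioids.pull Φ (α.hom.app B') x = x) → α = 1) h :=
  h.cor38_ii_weak_of_coord hF₁ hF₂ (TemperedFrobenioid.hP34Λ_ofGaloisActionConnected_weak A hZ hpf)
    (C₁.exists_cnstFn_effective_ofRlfZWeak_of_prop34Const hC₁) (C₁.hQ_of_eq_mrange hΦ₁)
    (TemperedFrobenioid.hFinv_ofGaloisActionConnected_weak A hZ hpf)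
    (TemperedFrobenioid.hP34Λ_ofGaloisActionConnected_weak A' hZ' hpf')
    (C₂.exists_cnstFn_effective_ofRlfZWeak_of_prop34Const hC₂) (C₂.hQ_of_eq_mrange hΦ₂)
    (TemperedFrobenioid.hFinv_ofGaloisActionConnected_weak A' hZ' hpf')

end Connected

/-! ## §3 The genuine category vocabulary over bases of FSM-type: residual {Φ-ties, `Prop34Const_i`, `IsOfFSMType D_i`} -/

section ConnectedFSM

variable {Z : LogDivisorModel.{u}} {G : Type u} [Group G] {A : Z.GaloisAction G} {hZ : Z.CuspLaws}
  {hpf : ∀ Y : ((isConnectedGSet (G := G)).FullSubcategory)ᵒᵖ,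
    IsPerfFactorialCof ((DivisorMonoids.ofGaloisActionConnected A hZ).Φ₀.obj Y)}
  {Z' : LogDivisorModel.{u}} {G' : Type u} [Group G'] {A' : Z'.GaloisAction G'} {hZ' : Z'.CuspLaws}
  {hpf' : ∀ Y : ((isConnectedGSet (G := G')).FullSubcategory)ᵒᵖ,
    IsPerfFactorialCof ((DivisorMonoids.ofGaloisActionConnected A' hZ').Φ₀.obj Y)}
  {D : Type u'} [Category.{v'} D] {IsRational IsStrictlyRational : (Dᵒᵖ ⥤ CommMonCat.{u}) → Prop}
  {D' : Type u'} [Category.{v'} D'] {IsRational' IsStrictlyRational' : (D'ᵒᵖ ⥤ CommMonCat.{u}) → Prop}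
  {C₁ : TemperedFrobenioid
    (RealifiedDivisorMonoids.ofRlfZWeak (DivisorMonoids.ofGaloisActionConnected A hZ) hpf) D
    (treeCatVocab D IsRational IsStrictlyRational)}
  {C₂ : TemperedFrobenioid
    (RealifiedDivisorMonoids.ofRlfZWeak (DivisorMonoids.ofGaloisActionConnected A' hZ') hpf') D'
    (treeCatVocab D' IsRational' IsStrictlyRational')}

/-- **[EtTh] Cor. 3.8 (i) AS TYPED at the constructed connected data over bases of FSM-type, genuine category vocabulary** — `hF_i`
CLOSED («`C` is a Frobenioid», [FrdI] Thm. 5.2 (ii): abc-iut-w5-d179's `isFrobenioid_of_isOfFSMType` with `hBinj :=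
DivisorMonoids.ofGaloisActionConnected_ofRlfZWeak_hBinj`); residual: `h`, the Φ-ties, `Prop34Const_i`, `IsOfFSMType D_i`.
[cite: MochizukiEtTh2009, Cor 3.8 p.80] -/
theorem cor38_i_ofGaloisActionConnected_of_isOfFSMType_of_eq_mrange (h : Cor38Hyp C₁ C₂)
    (hD : IsOfFSMType D) (hD' : IsOfFSMType D')
    (hΦ₁ : ∀ B : Dᵒᵖ, C₁.Φ.carrier B = MonoidHom.mrange (hpf (C₁.baseOp B)).weak.toRealification)
    (hΦ₂ : ∀ B : D'ᵒᵖ, C₂.Φ.carrier B = MonoidHom.mrange (hpf' (C₂.baseOp B)).weak.toRealification)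
    (hC₁ : (DivisorMonoids.ofGaloisActionConnected A hZ).Prop34Const)
    (hC₂ : (DivisorMonoids.ofGaloisActionConnected A' hZ').Prop34Const) :
    Literature.AnabelianGeometry.EtaleTheta.Cor38_i
      (fun E _ => Literature.AlgebraicGeometry.Frobenioids.IsFrobeniusSlim E) h :=
  h.cor38_i_ofGaloisActionConnected_of_isFrobenioid_of_eq_mrange
    (C₁.isFrobenioid_of_isOfFSMType (DivisorMonoids.ofGaloisActionConnected_ofRlfZWeak_hBinj A hZ hpf) hD)
    (C₂.isFrobenioid_of_isOfFSMType (DivisorMonoids.ofGaloisActionConnected_ofRlfZWeak_hBinj A' hZ' hpf') hD')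
    hΦ₁ hΦ₂ hC₁ hC₂

/-- **[EtTh] Cor. 3.8 (ii) AS TYPED at the constructed connected data over bases of FSM-type, genuine category vocabulary** (same
residual). [cite: MochizukiEtTh2009, Cor 3.8 p.81] -/
theorem cor38_ii_ofGaloisActionConnected_of_isOfFSMType_of_eq_mrange (h : Cor38Hyp C₁ C₂)
    (hD : IsOfFSMType D) (hD' : IsOfFSMType D')
    (hΦ₁ : ∀ B : Dᵒᵖ, C₁.Φ.carrier B = MonoidHom.mrange (hpf (C₁.baseOp B)).weak.toRealification)
    (hΦ₂ : ∀ B : D'ᵒᵖ, C₂.Φ.carrier B = MonoidHom.mrange (hpf' (C₂.baseOp B)).weak.toRealification)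
    (hC₁ : (DivisorMonoids.ofGaloisActionConnected A hZ).Prop34Const)
    (hC₂ : (DivisorMonoids.ofGaloisActionConnected A' hZ').Prop34Const) :
    Literature.AnabelianGeometry.EtaleTheta.Cor38_ii
      (fun E _ Φ => ∀ (B : E) (α : Aut (Over.forget B)),
        (∀ (B' : Over B) (x : Φ.obj (op B'.left)),
          Literature.AlgebraicGeometry.Frobenioids.pull Φ (α.hom.app B') x = x) → α = 1) h :=
  h.cor38_ii_ofGaloisActionConnected_of_isFrobenioid_of_eq_mrange
    (C₁.isFrobenioid_of_isOfFSMType (DivisorMonoids.ofGaloisActionConnected_ofRlfZWeak_hBinj A hZ hpf) hD)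
    (C₂.isFrobenioid_of_isOfFSMType (DivisorMonoids.ofGaloisActionConnected_ofRlfZWeak_hBinj A' hZ' hpf') hD')
    hΦ₁ hΦ₂ hC₁ hC₂

end ConnectedFSM

/-! ## §4 The GENUINE bases `B^temp(Π)⁰`: residual {Φ-ties, `Prop34Const_i`} -/

section ConnectedGenuineBase

variable {Z : LogDivisorModel.{u}} {G : Type u} [Group G] {A : Z.GaloisAction G} {hZ : Z.CuspLaws}
  {hpf : ∀ Y : ((isConnectedGSet (G := G)).FullSubcategory)ᵒᵖ,
    IsPerfFactorialCof ((DivisorMonoids.ofGaloisActionConnected A hZ).Φ₀.obj Y)}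
  {Z' : LogDivisorModel.{u}} {G' : Type u} [Group G'] {A' : Z'.GaloisAction G'} {hZ' : Z'.CuspLaws}
  {hpf' : ∀ Y : ((isConnectedGSet (G := G')).FullSubcategory)ᵒᵖ,
    IsPerfFactorialCof ((DivisorMonoids.ofGaloisActionConnected A' hZ').Φ₀.obj Y)}
  {P : Type v'} [Group P] [TopologicalSpace P]
  {IsRational IsStrictlyRational : ((ConnectedPart (BTemp P))ᵒᵖ ⥤ CommMonCat.{u}) → Prop}
  {P' : Type v'} [Group P'] [TopologicalSpace P']
  {IsRational' IsStrictlyRational' : ((ConnectedPart (BTemp P'))ᵒᵖ ⥤ CommMonCat.{u}) → Prop}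
  {C₁ : TemperedFrobenioid
    (RealifiedDivisorMonoids.ofRlfZWeak (DivisorMonoids.ofGaloisActionConnected A hZ) hpf)
    (ConnectedPart (BTemp P)) (treeCatVocab (ConnectedPart (BTemp P)) IsRational IsStrictlyRational)}
  {C₂ : TemperedFrobenioid
    (RealifiedDivisorMonoids.ofRlfZWeak (DivisorMonoids.ofGaloisActionConnected A' hZ') hpf')
    (ConnectedPart (BTemp P')) (treeCatVocab (ConnectedPart (BTemp P')) IsRational' IsStrictlyRational')}

/-- **[EtTh] Cor. 3.8 (i) AS TYPED at the constructed connected data over the GENUINE bases `B^temp(Π)⁰`, `B^temp(Π′)⁰`** (any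
topological groups `Π`, `Π′`; `hF_i` UNCONDITIONAL there: abc-iut-w5-d179's `isFrobenioid_connectedPart_bTemp`): residual = `h`, the
Φ-ties, `Prop34Const_i` — nothing else. [cite: MochizukiEtTh2009, Cor 3.8 p.80] -/
theorem cor38_i_ofGaloisActionConnected_connectedPart_bTemp_of_eq_mrange (h : Cor38Hyp C₁ C₂)
    (hΦ₁ : ∀ B : (ConnectedPart (BTemp P))ᵒᵖ,
      C₁.Φ.carrier B = MonoidHom.mrange (hpf (C₁.baseOp B)).weak.toRealification)
    (hΦ₂ : ∀ B : (ConnectedPart (BTemp P'))ᵒᵖ,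
      C₂.Φ.carrier B = MonoidHom.mrange (hpf' (C₂.baseOp B)).weak.toRealification)
    (hC₁ : (DivisorMonoids.ofGaloisActionConnected A hZ).Prop34Const)
    (hC₂ : (DivisorMonoids.ofGaloisActionConnected A' hZ').Prop34Const) :
    Literature.AnabelianGeometry.EtaleTheta.Cor38_i
      (fun E _ => Literature.AlgebraicGeometry.Frobenioids.IsFrobeniusSlim E) h :=
  h.cor38_i_ofGaloisActionConnected_of_isFrobenioid_of_eq_mrange
    (C₁.isFrobenioid_connectedPart_bTemp (DivisorMonoids.ofGaloisActionConnected_ofRlfZWeak_hBinj A hZ hpf))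
    (C₂.isFrobenioid_connectedPart_bTemp (DivisorMonoids.ofGaloisActionConnected_ofRlfZWeak_hBinj A' hZ' hpf'))
    hΦ₁ hΦ₂ hC₁ hC₂

/-- **[EtTh] Cor. 3.8 (ii) AS TYPED at the constructed connected data over the GENUINE bases `B^temp(Π)⁰`, `B^temp(Π′)⁰`** (residual =
`h`, the Φ-ties, `Prop34Const_i`). [cite: MochizukiEtTh2009, Cor 3.8 p.81] -/
theorem cor38_ii_ofGaloisActionConnected_connectedPart_bTemp_of_eq_mrange (h : Cor38Hyp C₁ C₂)
    (hΦ₁ : ∀ B : (ConnectedPart (BTemp P))ᵒᵖ,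
      C₁.Φ.carrier B = MonoidHom.mrange (hpf (C₁.baseOp B)).weak.toRealification)
    (hΦ₂ : ∀ B : (ConnectedPart (BTemp P'))ᵒᵖ,
      C₂.Φ.carrier B = MonoidHom.mrange (hpf' (C₂.baseOp B)).weak.toRealification)
    (hC₁ : (DivisorMonoids.ofGaloisActionConnected A hZ).Prop34Const)
    (hC₂ : (DivisorMonoids.ofGaloisActionConnected A' hZ').Prop34Const) :
    Literature.AnabelianGeometry.EtaleTheta.Cor38_ii
      (fun E _ Φ => ∀ (B : E) (α : Aut (Over.forget B)),
        (∀ (B' : Over B) (x : Φ.obj (op B'.left)),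
          Literature.AlgebraicGeometry.Frobenioids.pull Φ (α.hom.app B') x = x) → α = 1) h :=
  h.cor38_ii_ofGaloisActionConnected_of_isFrobenioid_of_eq_mrange
    (C₁.isFrobenioid_connectedPart_bTemp (DivisorMonoids.ofGaloisActionConnected_ofRlfZWeak_hBinj A hZ hpf))
    (C₂.isFrobenioid_connectedPart_bTemp (DivisorMonoids.ofGaloisActionConnected_ofRlfZWeak_hBinj A' hZ' hpf'))
    hΦ₁ hΦ₂ hC₁ hC₂

end ConnectedGenuineBase

end Cor38Hyp

end Literature.AnabelianGeometry.EtaleTheta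

end
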